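import Mathlib.Analysis.SpecialFunctions.ExpDeriv
import Literature.Analysis.FluidPDE.NSWave0
import Literature.Analysis.FluidPDE.ClassicalSolution
import Literature.Claims.NS.ClayVariants
import HarnessLib

/-!
# Claim skeleton (D-0090 NS-CLAIMS, C127, T3 QUICK tranche tail): Sghiar 2016 — «The Navier-stokes equation have a solution, Moreover, any solution (u, p) must check …»

Typed skeleton (ns-claims-typist-7 g2; RULINGS v1.29l (4) / v1.29n (2), QUICK statement grain) of
M. Sghiar, *Turbulent Functions and Solving the Navier-Stokes Equation by Fourier Series*, International
Journal of Engineering and Advanced Technology 6(1) (October 2016) 79–80 = HAL **hal-01383243 v3**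
(submitted 2016-10-24; the only version served; no DOI) = bib `Sghiar2016`; sources
`pub/ns-claims/sources/Sghiar2016/hal-01383243v3/` (8 PDF pp.; **PDF p.1 = HAL cover; PDF pages cited**;
`pages/p001–p008.txt`, renders; LOCATORS.md by ns-claims-lit-3 g2). UNREFEREED-GRADE CLAIM under
adjudication — NOTHING in this file asserts a step of the paper: its statements are `def … : Prop`;
the `theorem`s are kernel-checked relations between them. Card `pub/ns-claims/claims/Sghiar2016/CARD.md`
(PREDICTION §4 frozen 2026-08-27T02:02Z, sha16 4b2cba1768e48d1e).

## The claimed statement (§V «Conclusion», PDF p.7 l.16–36, verbatim)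

«Theorem: The Navier-stokes equation have a solution, Moreover, any solution (u, p) must check:
uᵢ² − α pᵢ = fᵢ(t) and ∂uᵢ/∂t = β ∂²uᵢ/∂xᵢ², ∀i ∈ {1,…,n}. where u = Σ₁ⁿ uᵢ eᵢ and p = Σ₁ⁿ pᵢ eᵢ.
Conversely any pair (n, p) [sic] satisfying these conditions with div u = 0 is solution of the
Navier-Stokes equation.» Setting §II p.3: «ρ(∂u/∂t + (u.∇u)) = −∇p + μ∇²u, div u = 0» in `n`
dimensions, «by dividing by ρ … ∂u/∂t + (u.∇u) = α∇p + β∇²u» (sign as printed; `β = μ/ρ`,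
`1/α = ρ` by Remark 2 p.7); framing p.2 l.15–18: «the Clay Mathematics Institute … made this problem [2]
one of its seven Millennium Prize problems … In this article I will prove that the Navier-Stokes
equation have a solutions» ([2] = claymath.org problem description).

TYPED at `n = 3` over the tree's classical solutions on `ℝ³` (`IsClassicalNSSolutionOn S ν 0 u p`,
scalar pressure, `ρ = 1` so `α`'s modulus is `1`, `β = ν`): `ClaimedTheorem := SolExists ∧ Step_heat ∧
Step_pressureRel ∧ Step_converse` — (a) «have a solution»: for every `ν > 0` some global classical
solution exists; (b) the universal HEAT CLAUSE: every classical solution satisfies, at interior times,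
`∂ₜuᵢ = ν ∂²uᵢ/∂xᵢ²` for each `i` (each component solves the 1-D heat equation in ITS OWN variable);
(c) the PRESSURE CLAUSE under the scalar reading `pᵢ := p` (the paper's `p = Σ pᵢeᵢ` is vector-valued —
Δ2, recorded): `x ↦ uᵢ(t,x)² − α p(t,x)` is constant in `x` for each `i`, typed with `|α| = 1` as
«`uᵢ² + p` or `uᵢ² − p` is constant in `x`» — see `Step_pressureRel`; (d) the converse.

## Clay delta (CARD §3): (A) is reached only through `ClayDelta`
Δ1 domain unstated (ℝⁿ, n arbitrary; typed ℝ³) · Δ2 vector pressure / sign «+α∇p» · Δ3 no force = ·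
Δ4 NO initial datum quantified — «have a solution» is an ∃-statement, not ∀-data · Δ5 no solution
class (the explicit field of §III p.5 is unbounded) · Δ6 = · Δ7 β > 0. `ClayDelta := ClaimedTheorem →
clayR3.Regularity` is the missing implication («a resolution of the Millennium problem»);
`clay_of_claimed_of_delta` is modus ponens. `solExists_holds`: clause (a) is TRUE by the rest state
(tree `isNavierStokesSolution_zero`-style: the zero pair is a classical solution) — recorded so the
refuter need not spend a line on it.

## Architecture as printed and the typed steps (PDF pages)

§III p.3 l.48 – p.5 l.14 («Existence»): componentwise ONE-VARIABLE ANSATZ «On each axis i, try to find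
the solutions of the form» `∂ₜuᵢ + uᵢ∂uᵢ/∂xᵢ = α∂pᵢ/∂xᵢ + β∂²uᵢ/∂xᵢ²` (p.4 l.1–12), solved by
`∂ₜuᵢ = β∂²uᵢ/∂xᵢ²` («analogous to the heat-equation which is resolvable by the Fourier series [1]»)
and `½uᵢ² − αpᵢ = fᵢ(t)`; `uₙ = −Σ_{i<n} uᵢ`; p.5 l.11–14: «Else, to have div u = 0, we take uᵢ of the
form: uᵢ = e^{βt + (Σ₁ⁿ xᵢ)}, ∀i ∈ {1,…,n−1}. So we have solutions of the Navier-Stokes equation.» —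
`Step_explicit` (the displayed field at n = 3: `u = e^{βt + x₁ + x₂ + x₃}(1, 1, −2)` is a classical
solution for SOME scalar pressure). §IV p.5 l.15 – p.7 l.15 («Necessary conditions»): «Any solution
(u, p) of the Navier-Stokes equation verifies that: uᵢ² − αpᵢ = fᵢ(t), ∀i» via «If (u, p) is a
solution … we must have ∂ₜuᵢ + ∂(½uᵢ² − αpᵢ)/∂xᵢ = β∂²uᵢ/∂xᵢ²» (p.5 l.19–24: the ansatz equation
asserted for ANY solution) and p.6 «When the fluid flows in one direction, then the space-time flows in
the opposite direction with the same speed value» — `Step_heat`, `Step_pressureRel`. §V Theorem p.7.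

ORDER OF RECORD (print order):
* Step 1 = `Step_explicit` — p.5 l.11–14.
* Step 2 = `Step_heat` — §IV p.5 l.19–24 / §V Theorem p.7 l.25–30 («∂uᵢ/∂t = β∂²uᵢ/∂xᵢ², ∀i» for
  any solution).
* Step 3 = `Step_pressureRel` — §IV p.5 l.16–18 / p.7 l.1–15 / Theorem p.7 («uᵢ² − αpᵢ = fᵢ(t), ∀i»).
* Step 4 = `Step_converse` — Theorem p.7 l.31–36.
* `SolExists` — Theorem p.7 l.17 («have a solution»; supported in print by Step 1).

COMPOSITION — PROVED, every step consumed: `claim_of_steps : Step_explicit → Step_heat →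
Step_pressureRel → Step_converse → ClaimedTheorem` (Step 1 feeds clause (a) through
`solExists_of_explicit`). Kernel handles for the refuter (no verdict here): `Step_heat` dies on any
shear mode varying ACROSS the stream, e.g. `u = (e^{−νt} sin x₂, 0, 0), p = 0` (tree
`Literature.Analysis.FluidPDE.ParallelShear.isClassicalNSSolutionOn_shear`: `∂ₜu₁ = −νu₁ ≠ 0 =
ν∂²u₁/∂x₁²`); `Step_pressureRel` dies on plane Couette `u = (x₂, 0, 0), p = 0` (`u₁² ± p = x₂²` is not
constant); `Step_explicit` dies because `e^{x₁+x₂+x₃}(1,1,−2)` is not a gradient (its curl is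
`−3e^{…}(1,−1,0) ≠ 0`) while `∂ₜu − νΔu + (u·∇)u = −2νu` would have to be `−∇p`.

WHAT THIS IS NOT: not a claim about NS regularity or blow-up; not a claim about any author beyond the
typed locator.
-/

open scoped ContDiff
open _root_.MeasureTheory _root_.Set Function

namespace Literature.Claims.NS.Sghiar2016

open Literature.Analysis.FluidPDE

noncomputable section

/-! ## A. Vocabulary -/

/-- Physical space `ℝ³` (the paper's `ℝⁿ` at `n = 3`). [cite: Sghiar2016, §II p.3] -/
abbrev E3 : Type := EuclideanSpace ℝ (Fin 3)

/-- The coordinate unit vector `eᵢ`. [cite: Sghiar2016, §V Theorem p.7] -/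
def e (i : Fin 3) : E3 := EuclideanSpace.single i (1 : ℝ)

/-- The second partial derivative `∂²g/∂xᵢ²` of a scalar function on `ℝ³` at `x` (iterated
directional Fréchet derivative along `eᵢ`). [cite: Sghiar2016, §II p.3 (∇²)] -/
def dii (g : E3 → ℝ) (i : Fin 3) (x : E3) : ℝ :=
  fderiv ℝ (fun y => fderiv ℝ g y (e i)) x (e i)

/-- The displayed explicit field of §III p.5 l.13 at `n = 3`: `uᵢ = e^{βt + x₁ + x₂ + x₃}` for
`i = 1, 2` and `u₃ = −(u₁ + u₂)`, i.e. `u = e^{βt + x₁ + x₂ + x₃} · (1, 1, −2)`.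
[cite: Sghiar2016, §III p.5 l.5–14] -/
def uExp (β : ℝ) (t : ℝ) (x : E3) : E3 :=
  Real.exp (β * t + (x 0 + x 1 + x 2)) • (WithLp.toLp 2 ![(1 : ℝ), 1, -2] : E3)

/-! ## B. The clauses of the §V Theorem (p.7) and the §III solution claim -/

/-- **Clause (a) of the Theorem p.7 l.17**: «The Navier-stokes equation have a solution» — for every
viscosity `β = ν > 0` there is a global classical solution `(u, p)` of the unforced system on
`ℝ³ × [0,∞)`. (No datum is quantified in print.) [claim: Sghiar2016, status: disputed] -/
def SolExists : Prop :=
  ∀ ν : ℝ, 0 < ν → ∃ (u : ℝ → E3 → E3) (p : ℝ → E3 → ℝ), IsClassicalNSSolutionOn (Ici 0) ν 0 u p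

/-- **Step 1 — §III p.5 l.11–14** «we take uᵢ of the form uᵢ = e^{βt + Σxᵢ} … So we have solutions of
the Navier-Stokes equation»: for every `β > 0` the displayed field `uExp β` is a classical solution
of the unforced system on `ℝ³ × ℝ` for SOME scalar pressure. [claim: Sghiar2016, status: disputed] -/
def Step_explicit : Prop :=
  ∀ β : ℝ, 0 < β → ∃ p : ℝ → E3 → ℝ, IsClassicalNSSolutionOn univ β 0 (uExp β) p

/-- **Step 2 — §IV p.5 l.19–24 / Theorem p.7** «any solution (u, p) must check … ∂uᵢ/∂t = β ∂²uᵢ/∂xᵢ²,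
∀i»: every classical unforced solution on a time set `S` satisfies, at every interior time and every
point, the one-dimensional heat equation componentwise in its own variable.
[claim: Sghiar2016, status: disputed] -/
def Step_heat : Prop :=
  ∀ (ν : ℝ) (S : Set ℝ) (u : ℝ → E3 → E3) (p : ℝ → E3 → ℝ), 0 < ν →
    IsClassicalNSSolutionOn S ν 0 u p →
      ∀ t ∈ interior S, ∀ (x : E3) (i : Fin 3),
        deriv (fun s => u s x i) t = ν * dii (fun y => u t y i) i x

/-- **Step 3 — §IV p.5 l.16–18, p.7 l.1–15 / Theorem p.7** «uᵢ² − α pᵢ = fᵢ(t), ∀i» under the scalar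
reading `pᵢ := p`, `|α| = 1/ρ = 1`: for every classical unforced solution, each `i` and each time
`t ∈ S`, one of `x ↦ uᵢ(t,x)² − p(t,x)`, `x ↦ uᵢ(t,x)² + p(t,x)` is constant in `x` (both signs of `α`
admitted — charitable). [claim: Sghiar2016, status: disputed] -/
def Step_pressureRel : Prop :=
  ∀ (ν : ℝ) (S : Set ℝ) (u : ℝ → E3 → E3) (p : ℝ → E3 → ℝ), 0 < ν →
    IsClassicalNSSolutionOn S ν 0 u p →
      ∀ t ∈ S, ∀ i : Fin 3,
        (∃ c : ℝ, ∀ x : E3, (u t x i) ^ 2 - p t x = c) ∨ (∃ c : ℝ, ∀ x : E3, (u t x i) ^ 2 + p t x = c)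

/-- **Step 4 — Theorem p.7 l.31–36, the converse**: a jointly smooth pair `(u, p)` on `ℝ³ × S` with
`div u = 0`, the heat clause and the pressure clause is a classical unforced solution.
[claim: Sghiar2016, status: disputed] -/
def Step_converse : Prop :=
  ∀ (ν : ℝ) (S : Set ℝ) (u : ℝ → E3 → E3) (p : ℝ → E3 → ℝ), 0 < ν → IsOpen S →
    IsSmoothSpaceTimeOn S u → IsSmoothSpaceTimeOn S p → (∀ t ∈ S, NSWave0.IsDivFree (u t)) →
    (∀ t ∈ S, ∀ (x : E3) (i : Fin 3), deriv (fun s => u s x i) t = ν * dii (fun y => u t y i) i x) →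
    (∀ t ∈ S, ∀ i : Fin 3,
      (∃ c : ℝ, ∀ x : E3, (u t x i) ^ 2 - p t x = c) ∨ (∃ c : ℝ, ∀ x : E3, (u t x i) ^ 2 + p t x = c)) →
      IsClassicalNSSolutionOn S ν 0 u p

/-- **The §V Theorem as a whole** (clauses (a)–(d)). [claim: Sghiar2016, status: disputed] -/
def ClaimedTheorem : Prop :=
  SolExists ∧ Step_heat ∧ Step_pressureRel ∧ Step_converse

/-- **The missing Clay implication** (p.2 l.10–18: «a resolution of the Navier-Stokes [2] equation»,
[2] = the Clay problem description): the Theorem would have to yield Fefferman's (A). Declared as a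
`Prop`; nothing in print supplies it (no datum is ever quantified). [claim: Sghiar2016, status: disputed] -/
def ClayDelta : Prop :=
  ClaimedTheorem → ClayVariants.clayR3.Regularity

/-! ## C. Kernel-checked relations (pure logic + the rest state; nothing of the paper is asserted) -/

/-- The rest state `(0, 0)` is a global classical unforced solution on `ℝ³` for every viscosity.
[cite: FeffermanClay2006, (1) (2) (6) p. 1] -/
private theorem isClassicalNSSolutionOn_zero (S : Set ℝ) (ν : ℝ) :
    IsClassicalNSSolutionOn S ν 0 (fun _ _ => (0 : E3)) (fun _ _ => (0 : ℝ)) := by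
  refine ⟨contDiffOn_const, contDiffOn_const, fun t _ x => ?_, fun t _ x => ?_⟩
  · have h1 : timeDerivWithin S (fun (_ : ℝ) (_ : E3) => (0 : E3)) t x = 0 := by
      simp [timeDerivWithin]
    have h2 : convect (fun _ : E3 => (0 : E3)) (fun _ : E3 => (0 : E3)) x = 0 := by
      simp [convect]
    have h3 : gradient (fun _ : E3 => (0 : ℝ)) x = 0 := by
      rw [gradient, fderiv_const_apply]; simp
    rw [h1, h2, h3, InnerProductSpace.laplacian_const]
    simp
  · simp [VectorCalculus.divergence, fderiv_const_apply]

/-- **Clause (a) holds** (rest state) — recorded so that the adjudication concerns the universal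
clauses. [cite: Sghiar2016, §V Theorem p.7 l.17] -/
theorem solExists_holds : SolExists :=
  fun ν _ => ⟨_, _, isClassicalNSSolutionOn_zero (Ici 0) ν⟩

/-- Step 1 supports clause (a): a global solution on `ℝ` restricts to `[0,∞)`.
[cite: Sghiar2016, §III p.5 l.11–14] -/
theorem solExists_of_explicit (h : Step_explicit) : SolExists := by
  intro ν hν
  obtain ⟨p, hp⟩ := h ν hν
  exact ⟨uExp ν, p, hp.mono (subset_univ _) (uniqueDiffOn_Ici 0)⟩

/-- **COMPOSITION** (§III → §IV → §V) — PROVED, every step consumed.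
[cite: Sghiar2016, §V Theorem p.7] -/
theorem claim_of_steps (h1 : Step_explicit) (h2 : Step_heat) (h3 : Step_pressureRel)
    (h4 : Step_converse) : ClaimedTheorem :=
  ⟨solExists_of_explicit h1, h2, h3, h4⟩

/-- **Clay link only modulo the delta** (modus ponens). [cite: FeffermanClay2006, (A) p. 2] -/
theorem clay_of_claimed_of_delta (hΔ : ClayDelta) (h : ClaimedTheorem) :
    ClayVariants.clayR3.Regularity :=
  hΔ h

end

end Literature.Claims.NS.Sghiar2016
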